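import Literature.AlgebraicGeometry.Motives.AbelianVarietyProjectiveChart
import Literature.AlgebraicGeometry.Motives.PrymVariety
import Literature.AlgebraicGeometry.Motives.Jacobian
import Literature.AlgebraicGeometry.HodgeTheory.WeilClassesIsogenyDescent
import Literature.AlgebraicTopology.SingularHomology.CupProductExteriorH1
import HarnessLib
import Literature.AlgebraicGeometry.HodgeTheory.WeilClassesCyclicPrym

/-!
# Schoen's cyclic theorem on the dicyclic datum, with isogeny invariance

Support file for crux `HeckePrymWeil.HyperbolicEightfoldsSqrtMinus7` (item stmt-HodgeConjecture-14642,
route route-HodgeConjecture-HeckePrymWeil), line `Sketch` (idea `dicyclic-quaternion-switch`), stub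
`stub_schoenDicyclic` of the skeleton `Cruxes/HyperbolicEightfoldsSqrtMinus7/Lines/Sketch.lean`.

## Content

* `Schoen1988_cyclicPrym_weilClasses_algebraic_degreeSix` — NAMED FACT (D-0014, not proved here):
  Schoen 1988 = Patel–Zhang 2025 Thm 1.2 / Thm 4.4 / Thm 5.3 with Lemma 5.1, for an étale CYCLIC cover
  of degree `6` of a genus-`5` curve by a genus-`25` curve (`h = 2·5 - 2 = 8`): the `ℚ(ζ₆)`-Weil plane
  `U_prim ⊗ ℂ = ⋀⁸ H¹(B)_{ζ₆} ⊕ ⋀⁸ H¹(B)_{ζ₆⁻¹} ⊂ H⁸(B(ℂ); ℂ)` of Schoen's primitive Prym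
  `B = B_prim = (ker Φ₆(α_*))⁰ ⊂ J(C)` consists of algebraic classes; typed on the tree's real carriers as
  the two eigenspaces of `(2·𝟙_B + ψ₀)^*` on `H⁸(B(ℂ); ℂ)`, `ψ₀ = 𝟙 + 2 s_B²`, for `(2 ± i√3)⁸`.
* `stub_schoenDicyclic_of_schoen` — PROVED: the registered stub `stub_schoenDicyclic` GIVEN that fact,
  i.e. the isogeny-transfer part: for every `(Y, ψ_Y)` with a `ℚ(√-3)`-equivariant isogeny pair
  `f : Y ⟶ B` (flat), `g : B ⟶ Y`, `f ≫ g = k·𝟙_Y`, `g ≫ ψ_Y = (m·ψ₀) ≫ g`, every class of the typed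
  plane `Eig((2m·𝟙_Y + ψ_Y)^*, m⁸(2 ± i√3)⁸) ⊆ H⁸(Y(ℂ); ℂ)` is algebraic (van Geemen 3.6–3.7: `g^*` maps
  the typed plane of `Y` into the typed `(2m·𝟙_B + m·ψ₀)`-plane of `B`, which is Schoen's plane because
  `(m·u)^* = m⁸·u^*` on `H⁸ = ⋀⁸ H¹`; then `f^* g^* c = (k·𝟙)^* c = k⁸·c` is a flat pull-back of an
  algebraic class).
* The dictionary lemmas it needs, all PROVED from the two `H¹` hypotheses of the stub (`hExt`:
  `H• = ⋀•H¹`, `hAdd`: `(f + g)^* = f^* + g^*` on `H¹`): `map_zero_deg_one` (`0^* = 0` on `H¹`),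
  `map_zsmul_deg_one` (`(m·u)^* = m·u^*` on `H¹`), `exteriorPower_map_smul`
  (`⋀ᵈ(c·T) = cᵈ·⋀ᵈT`, pure Mathlib), `map_zsmul_of_hasExteriorCohomologyH1` (`(m·u)^* = mᵈ·u^*` on
  `Hᵈ`), `map_mem_eigenspace_of_comm` (eigen-plane transport along an intertwining homomorphism).

## References

* [PatelZhang2025PrymHodge] D. Patel, Y. Zhang, *Algebraicity of Hodge classes on some generalized Prym
  varieties*, arXiv:2506.13729 (2025): Thm 1.2 (p. 3), §2.6 (p. 7, `U_Weil ⊗ ℂ` and its basis of pure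
  wedges), Thm 4.4 (pp. 10–11), §5: Lemma 5.1, Def 5.2, Thm 5.3 "(Schoen88) `U_prim` is generated by
  algebraic cycles" (p. 12). Held and read: `paper:arxiv-2506.13729`.
* [Schoen1988HodgeWeil] C. Schoen, *Hodge classes on self-products of a variety with an automorphism*,
  Compositio Math. 65 (1988) 3–32 (the cyclic étale case; = PZ Thm 5.3).
* [vanGeemen1994HodgeAV] B. van Geemen, LNM 1594 (1994), 3.6–3.7 (isogeny invariance).
-/

noncomputable section
-- every declaration of this problem lives in Summit.HodgeConjecture.HodgeConjecture.… (summit = problem)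
set_option linter.dupNamespace false

open CategoryTheory
open Literature.AlgebraicGeometry Literature.AlgebraicGeometry.Motives
  Literature.AlgebraicGeometry.HodgeTheory Literature.AlgebraicTopology.SingularHomology

namespace Summit.HodgeConjecture.HodgeConjecture.Theorems.HyperbolicEightfoldsSqrtMinus7.DicyclicQuaternionSwitch

/-! ### The Schoen core (named fact) -/

section Dictionary

variable {A B D : AbelianVariety ℂ}

/-- `u^*(w^* c) = (u ≫ w)^* c` for homomorphisms of abelian varieties, in the `complexBetti.map`
spelling (the tree's `abelianVarietyHom_map_map_apply`). -/
theorem map_map_apply {k : ℕ} (u : A ⟶ B) (w : B ⟶ D) (c : complexBetti D.X k) :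
    complexBetti.map u.hom.hom.hom k (complexBetti.map w.hom.hom.hom k c) =
      complexBetti.map (u ≫ w).hom.hom.hom k c :=
  abelianVarietyHom_map_map_apply u w c

/-- `(𝟙 A)^* c = c`. -/
theorem map_id_apply {k : ℕ} (c : complexBetti A.X k) :
    complexBetti.map (𝟙 A : A ⟶ A).hom.hom.hom k c = c := by
  have h : (𝟙 A : A ⟶ A).hom.hom.hom = 𝟙 A.X := rfl
  rw [h, complexBetti.map_id]
  rfl

/-- **`0^* = 0` on `H¹`**, from additivity: `0^* v = (0 + 0)^* v = 0^* v + 0^* v`. -/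
theorem map_zero_deg_one
    (hAdd : ∀ (A : AbelianVariety ℂ) (f g : A ⟶ A) (v : complexBetti A.X 1),
      complexBetti.map (f + g).hom.hom.hom 1 v =
        complexBetti.map f.hom.hom.hom 1 v + complexBetti.map g.hom.hom.hom 1 v)
    (v : complexBetti A.X 1) :
    complexBetti.map (0 : A ⟶ A).hom.hom.hom 1 v = 0 := by
  have h := hAdd A 0 0 v
  rw [add_zero] at h
  have h' : complexBetti.map (0 : A ⟶ A).hom.hom.hom 1 v + complexBetti.map (0 : A ⟶ A).hom.hom.hom 1 v =
      complexBetti.map (0 : A ⟶ A).hom.hom.hom 1 v + 0 := by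
    rw [add_zero]; exact h.symm
  exact add_left_cancel h'

/-- **`(m • u)^* = m • u^*` on `H¹`** for `m : ℤ` (additivity `hAdd` by induction on `m`). -/
theorem map_zsmul_deg_one
    (hAdd : ∀ (A : AbelianVariety ℂ) (f g : A ⟶ A) (v : complexBetti A.X 1),
      complexBetti.map (f + g).hom.hom.hom 1 v =
        complexBetti.map f.hom.hom.hom 1 v + complexBetti.map g.hom.hom.hom 1 v)
    (u : A ⟶ A) (m : ℤ) (v : complexBetti A.X 1) :
    complexBetti.map (m • u).hom.hom.hom 1 v = (m : ℂ) • complexBetti.map u.hom.hom.hom 1 v := by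
  induction m using Int.induction_on with
  | zero => rw [zero_smul, Int.cast_zero, zero_smul]; exact map_zero_deg_one hAdd v
  | succ n ih =>
    rw [add_smul, one_smul, hAdd, ih, Int.cast_add, Int.cast_one, add_smul, one_smul]
  | pred n ih =>
    have h := hAdd A (-(n : ℤ) • u - u) u v
    rw [sub_add_cancel] at h
    rw [sub_smul, one_smul, eq_sub_of_add_eq h.symm, ih, Int.cast_sub, Int.cast_one, sub_smul,
      one_smul]

/-- **`⋀ᵈ(c • T) = cᵈ • ⋀ᵈ T`** (multilinearity of `ιMulti` on pure wedges; pure Mathlib). -/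
theorem exteriorPower_map_smul {R M N : Type*} [CommRing R] [AddCommGroup M] [Module R M]
    [AddCommGroup N] [Module R N] (d : ℕ) (c : R) (T : M →ₗ[R] N) :
    exteriorPower.map d (c • T) = c ^ d • exteriorPower.map d T := by
  refine exteriorPower.linearMap_ext ?_
  ext m
  simp only [LinearMap.compAlternatingMap_apply, exteriorPower.map_apply_ιMulti,
    LinearMap.smul_apply]
  have h : ((c • T) ∘ m) = fun i => c • (T ∘ m) i := rfl
  rw [h, AlternatingMap.map_smul_univ, Finset.prod_const, Finset.card_univ, Fintype.card_fin]

/-- **`(m • u)^* = mᵈ • u^*` on `Hᵈ(A(ℂ); ℂ)`**, from `Hᵈ = ⋀ᵈ H¹` (`hExt`: `wedgeToCup` surjective,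
and natural: `map_wedgeToCup`) and `(m • u)^* = m • u^*` on `H¹` (`hAdd`). -/
theorem map_zsmul_of_hasExteriorCohomologyH1
    (hExt : ∀ A : AbelianVariety ℂ,
      HasExteriorCohomologyH1 ℂ (ComplexPoints A.X) ∧ Module.finrank ℂ (complexBetti A.X 1) = 2 * A.dim)
    (hAdd : ∀ (A : AbelianVariety ℂ) (f g : A ⟶ A) (v : complexBetti A.X 1),
      complexBetti.map (f + g).hom.hom.hom 1 v =
        complexBetti.map f.hom.hom.hom 1 v + complexBetti.map g.hom.hom.hom 1 v)
    (d : ℕ) (u : A ⟶ A) (m : ℤ) (c : complexBetti A.X d) :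
    complexBetti.map (m • u).hom.hom.hom d c = (m : ℂ) ^ d • complexBetti.map u.hom.hom.hom d c := by
  obtain ⟨x, rfl⟩ := ((hExt A).1 d).2 c
  have h1 : (complexBetti.map (m • u).hom.hom.hom 1).hom = (m : ℂ) • (complexBetti.map u.hom.hom.hom 1).hom :=
    LinearMap.ext fun v => map_zsmul_deg_one hAdd u m v
  -- naturality of the comparison map (the tree's `map_wedgeToCup`, Hatcher Prop. 3.10), `complexBetti` spelling
  have hw : ∀ (w : A ⟶ A) (y : ⋀[ℂ]^d (complexBetti A.X 1)),
      complexBetti.map w.hom.hom.hom d (wedgeToCup ℂ (ComplexPoints A.X) d y) =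
        wedgeToCup ℂ (ComplexPoints A.X) d (exteriorPower.map d (complexBetti.map w.hom.hom.hom 1).hom y) :=
    fun w y => map_wedgeToCup _ d y
  rw [hw, hw, h1, exteriorPower_map_smul, LinearMap.smul_apply, map_smul]

/-- **Eigen-plane transport along an intertwining homomorphism**: if `uB ≫ g = g ≫ uY` then `g^*`
maps `Eig(uY^*, μ)` into `Eig(uB^*, μ)` (`uB^* g^* c = (uB ≫ g)^* c = (g ≫ uY)^* c = g^* (μ c)`). -/
theorem map_mem_eigenspace_of_comm {k : ℕ} {uB : B ⟶ B} {uY : A ⟶ A} {g : B ⟶ A}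
    (hg : uB ≫ g = g ≫ uY) {μ : ℂ} {c : complexBetti A.X k}
    (hc : c ∈ Module.End.eigenspace (complexBetti.map uY.hom.hom.hom k).hom μ) :
    complexBetti.map g.hom.hom.hom k c ∈ Module.End.eigenspace (complexBetti.map uB.hom.hom.hom k).hom μ := by
  rw [Module.End.mem_eigenspace_iff] at hc ⊢
  change complexBetti.map uB.hom.hom.hom k (complexBetti.map g.hom.hom.hom k c) =
    μ • complexBetti.map g.hom.hom.hom k c
  rw [map_map_apply, hg, ← map_map_apply]
  change complexBetti.map g.hom.hom.hom k ((complexBetti.map uY.hom.hom.hom k).hom c) = _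
  rw [hc, map_smul]

/-- Rescaling an eigen-equation: `Eig(a • T, a·μ) ≤ Eig(T, μ)` for `a ≠ 0`. -/
theorem mem_eigenspace_of_mem_eigenspace_smul {V : Type*} [AddCommGroup V] [Module ℂ V]
    {T : Module.End ℂ V} {a μ : ℂ} (ha : a ≠ 0) {x : V}
    (hx : x ∈ Module.End.eigenspace (a • T) (a * μ)) : x ∈ Module.End.eigenspace T μ := by
  rw [Module.End.mem_eigenspace_iff] at hx ⊢
  rw [LinearMap.smul_apply, mul_smul] at hx
  exact smul_right_injective V ha hx

end Dictionary

/-! ### The registered stub, given the Schoen core -/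

/-- **Stub `stub_schoenDicyclic` of line `Sketch`, GIVEN the Schoen core
`Schoen1988_cyclicPrym_weilClasses_algebraic_degreeSix`** (first hypothesis; the rest is the registered
signature of `stub_schoenDicyclic` verbatim).  PROOF (van Geemen 3.6–3.7 pattern, `WeilClassesIsogenyDescent`): for `c` in the typed
`(2m·𝟙_Y + ψ_Y)`-plane of `Y`, (1) `g^* c` lies in the typed `(2m·𝟙_B + m·ψ₀)`-plane of `B`
(`(2m·𝟙_B + m·ψ₀) ≫ g = g ≫ (2m·𝟙_Y + ψ_Y)` by bilinearity and `g ≫ ψ_Y = (m·ψ₀) ≫ g`;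
`map_mem_eigenspace_of_comm`); (2) `2m·𝟙_B + m·ψ₀ = m·(2·𝟙_B + ψ₀)` and `(m·u)^* = m⁸·u^*` on `H⁸`
(`map_zsmul_of_hasExteriorCohomologyH1`, from `hExt`, `hAdd`), so `g^* c` lies in Schoen's plane
`Eig((2·𝟙_B + ψ₀)^*, (2 ± i√3)⁸)`, hence is algebraic (`hS`); (3) `f^*(g^* c) = (f ≫ g)^* c =
(k·𝟙_Y)^* c = k⁸·c` is algebraic by flat pull-back (`map_mem_algebraicClasses_of_flat`; `Y`, `B` are
locally Noetherian as smooth projective varieties), and `k⁸ ≠ 0`.  The dicyclic data `ξ`, `x`, `x_B`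
are carried, not used. -/
theorem stub_schoenDicyclic_of_schoen :
    Literature.AlgebraicGeometry.HodgeTheory.Schoen1988_cyclicPrym_weilClasses_algebraic_degreeSix →
    (∀ A : AbelianVariety ℂ,
      HasExteriorCohomologyH1 ℂ (ComplexPoints A.X) ∧ Module.finrank ℂ (complexBetti A.X 1) = 2 * A.dim) →
    (∀ (A : AbelianVariety ℂ) (f g : A ⟶ A) (v : complexBetti A.X 1),
      complexBetti.map (f + g).hom.hom.hom 1 v =
        complexBetti.map f.hom.hom.hom 1 v + complexBetti.map g.hom.hom.hom 1 v) →
    ∀ (C : SchemeOver ℂ) (𝒥 : Jacobian C) (α ξ : C ⟶ C),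
      IsSmoothProjective 1 C → 𝒥.J.dim = 25 →
      α ≫ α ≫ α ≫ α ≫ α ≫ α = 𝟙 C → ξ ≫ ξ = α ≫ α ≫ α → α ≫ ξ ≫ α = ξ →
      (∀ P : ComplexPoints C, P ≫ (α ≫ α) ≠ P ∧ P ≫ (α ≫ α ≫ α) ≠ P) →
    ∀ (s x : 𝒥.J ⟶ 𝒥.J), s = 𝒥.pushforward 𝒥 α → x = 𝒥.pushforward 𝒥 ξ →
    ∀ (sB xB ψ₀ : AbelianVariety.kerComponent (𝟙 𝒥.J - s + s ≫ s) ⟶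
        AbelianVariety.kerComponent (𝟙 𝒥.J - s + s ≫ s)),
      sB ≫ AbelianVariety.kerComponentι (𝟙 𝒥.J - s + s ≫ s) =
        AbelianVariety.kerComponentι (𝟙 𝒥.J - s + s ≫ s) ≫ s →
      xB ≫ AbelianVariety.kerComponentι (𝟙 𝒥.J - s + s ≫ s) =
        AbelianVariety.kerComponentι (𝟙 𝒥.J - s + s ≫ s) ≫ x →
      ψ₀ = 𝟙 _ + 2 • (sB ≫ sB) →
    ∀ (Y : AbelianVariety ℂ) (ψY : Y ⟶ Y) (m k : ℕ)
      (f : Y ⟶ AbelianVariety.kerComponent (𝟙 𝒥.J - s + s ≫ s))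
      (g : AbelianVariety.kerComponent (𝟙 𝒥.J - s + s ≫ s) ⟶ Y),
      0 < m → 0 < k → AlgebraicGeometry.Flat f.hom.hom.hom.left → f ≫ g = (k : ℤ) • 𝟙 Y →
      g ≫ ψY = ((m : ℤ) • ψ₀) ≫ g → f ≫ ((m : ℤ) • ψ₀) = ψY ≫ f →
    ∀ c : complexBetti Y.X 8,
      c ∈ Module.End.eigenspace (complexBetti.map ((2 * (m : ℤ)) • 𝟙 Y + ψY).hom.hom.hom 8).hom
            ((m : ℂ) ^ 8 * (2 + Complex.I * (Real.sqrt (3 : ℝ) : ℂ)) ^ 8) ⊔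
          Module.End.eigenspace (complexBetti.map ((2 * (m : ℤ)) • 𝟙 Y + ψY).hom.hom.hom 8).hom
            ((m : ℂ) ^ 8 * (2 - Complex.I * (Real.sqrt (3 : ℝ) : ℂ)) ^ 8) →
      c ∈ algebraicClasses Y.X 4 := by
  intro hS hExt hAdd C 𝒥 α ξ hC h25 hα6 _hξ2 _hrel hfree s x hs _hx
  -- notation: `B = (ker Φ₆(s))⁰`
  set B := AbelianVariety.kerComponent (𝟙 𝒥.J - s + s ≫ s) with hBdef
  intro sB xB ψ₀ hsB _hxB hψ₀ Y ψY m k f g hm hk hflat hfg hgψ _hfψ c hc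
  -- Schoen's operator on `B` and its `m`-multiple
  set u₀ : B ⟶ B := (2 : ℤ) • 𝟙 B + ψ₀ with hu₀
  have hmu₀ : ((2 * (m : ℤ)) • 𝟙 B + (m : ℤ) • ψ₀ : B ⟶ B) = (m : ℤ) • u₀ := by
    rw [hu₀, smul_add, smul_smul, mul_comm]
  -- (1) the intertwining relation and the transport of the typed plane along `g^*`
  have hcomm : ((2 * (m : ℤ)) • 𝟙 B + (m : ℤ) • ψ₀) ≫ g = g ≫ ((2 * (m : ℤ)) • 𝟙 Y + ψY) := by
    rw [Preadditive.add_comp, Preadditive.comp_add, Preadditive.zsmul_comp, Preadditive.comp_zsmul,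
      Category.id_comp, Category.comp_id, hgψ]
  have hmC : (m : ℂ) ≠ 0 := Nat.cast_ne_zero.mpr hm.ne'
  have hm8 : (m : ℂ) ^ 8 ≠ 0 := pow_ne_zero _ hmC
  -- (2) `(m • u₀)^* = m⁸ • u₀^*` on `H⁸(B)`, as linear maps
  have hscale : (complexBetti.map ((2 * (m : ℤ)) • 𝟙 B + (m : ℤ) • ψ₀).hom.hom.hom 8).hom =
      (m : ℂ) ^ 8 • (complexBetti.map u₀.hom.hom.hom 8).hom := by
    rw [hmu₀]
    refine LinearMap.ext fun y => ?_
    have e := map_zsmul_of_hasExteriorCohomologyH1 hExt hAdd 8 u₀ (m : ℤ) y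
    rw [Int.cast_natCast] at e
    exact e
  -- `g^* c` lies in Schoen's plane
  have hgc : complexBetti.map g.hom.hom.hom 8 c ∈
      Module.End.eigenspace (complexBetti.map u₀.hom.hom.hom 8).hom
          ((2 + Complex.I * (Real.sqrt (3 : ℝ) : ℂ)) ^ 8) ⊔
        Module.End.eigenspace (complexBetti.map u₀.hom.hom.hom 8).hom
          ((2 - Complex.I * (Real.sqrt (3 : ℝ) : ℂ)) ^ 8) := by
    rw [Submodule.mem_sup] at hc ⊢
    obtain ⟨c₁, h₁, c₂, h₂, rfl⟩ := hc
    refine ⟨complexBetti.map g.hom.hom.hom 8 c₁, ?_, complexBetti.map g.hom.hom.hom 8 c₂, ?_,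
      (map_add _ _ _).symm⟩
    · have t := map_mem_eigenspace_of_comm hcomm h₁
      rw [hscale] at t
      exact mem_eigenspace_of_mem_eigenspace_smul hm8 t
    · have t := map_mem_eigenspace_of_comm hcomm h₂
      rw [hscale] at t
      exact mem_eigenspace_of_mem_eigenspace_smul hm8 t
  -- Schoen: `g^* c` is algebraic on `B`
  have halgB : complexBetti.map g.hom.hom.hom 8 c ∈ algebraicClasses B.X 4 :=
    hS C 𝒥 α hC h25 hα6 hfree s hs sB ψ₀ hsB hψ₀ _ hgc
  -- (3) flat pull-back along `f`
  haveI : AlgebraicGeometry.Flat f.hom.hom.hom.left := hflat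
  haveI : AlgebraicGeometry.IsLocallyNoetherian Y.X.left :=
    Motives.IsSmoothProjective.isLocallyNoetherian_holds (AbelianVariety.isSmoothProjective_holds (A := Y))
  haveI : AlgebraicGeometry.IsLocallyNoetherian B.X.left :=
    Motives.IsSmoothProjective.isLocallyNoetherian_holds (AbelianVariety.isSmoothProjective_holds (A := B))
  have hfc := map_mem_algebraicClasses_of_flat (p := 4) f.hom.hom.hom halgB
  -- `f^* g^* c = (f ≫ g)^* c = (k • 𝟙 Y)^* c = k⁸ • c`
  have key : complexBetti.map f.hom.hom.hom (2 * 4) (complexBetti.map g.hom.hom.hom 8 c) =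
      ((k : ℂ) ^ 8) • c := by
    change complexBetti.map f.hom.hom.hom 8 (complexBetti.map g.hom.hom.hom 8 c) = _
    rw [map_map_apply, hfg]
    have e := map_zsmul_of_hasExteriorCohomologyH1 hExt hAdd 8 (𝟙 Y) (k : ℤ) c
    rw [Int.cast_natCast, map_id_apply] at e
    exact e
  rw [key] at hfc
  have hkC : ((k : ℂ) ^ 8) ≠ 0 := pow_ne_zero _ (Nat.cast_ne_zero.mpr hk.ne')
  exact (Submodule.smul_mem_iff _ hkC).mp hfc

end Summit.HodgeConjecture.HodgeConjecture.Theorems.HyperbolicEightfoldsSqrtMinus7.DicyclicQuaternionSwitch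

end
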